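import Mathlib
import HarnessLib
import Summits.NavierStokesRegularity.NavierStokesRegularity.Theorems.PoloidalWindowDoorLrcModEntireTwistingTHOscUniversalWeight

/-!
# Item `LrcModEntire` (stmt-NavierStokesRegularity-20428), CLASS road — the explicit universal Lyapunov weight for (OSC), appendix:
# Gaussian decay of the SECOND derivative and `exists_universalWeight₂` (the shape consumed by `…TwistingTHOscAncientLiouville._gaussian`)

Cell ns-regularity-ideate, LEAD ns-poloidal-K2-p3 g13 (`--supports stmt-NavierStokesRegularity-20428`; sequel of `…OscUniversalWeight`, asked by
ns-k2-port-2 g3 01:15:29Z: the second integration by parts `∫w′Q_ξ = −∫w″Q` needs `w″Q ∈ L¹`, and (UW) bounds `w″` only from above).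
* `abs_wR2_le` — tail curvature `|w_R″(ξ)| ≤ 4e^{κA²}e^{−(κ/4)ξ²}` (`ξ ≥ A`; via `u²e^{−κu²/2} ≤ 2/κ`);
* `decay_deriv_deriv_of_nonneg` — `|w″| ≤ 4e^{κA²}e^{−(κ/4)ξ²}` on `[0,∞)` (on `[0,A]`, `|w″| = γe^{Aξ/2} ≤ 1/16`);
* `exists_universalWeight₂` — `exists_universalWeight` plus the conjunct `|w″(ξ)| ≤ C·e^{−κξ²}` (same `γ = e^{−A²/2}/16`, `κ/4`, `C = 4e^{κA²}`, `w`).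

WHAT THIS IS NOT: not a claim about Navier–Stokes regularity and not the stub — one-variable real analysis (bears_on LADDER-NS N0, item 20428 / crux 19708;
both OPEN).
-/

noncomputable section

-- the summit and its single sub-problem share the name (CONVENTIONS §1), as in every Theorems file
set_option linter.dupNamespace false

namespace Summit.NavierStokesRegularity.NavierStokesRegularity.Theorems.PoloidalWindowDoorLrcModEntireTwistingTHOscUniversalWeightCurvature

open Set Filter Topology MeasureTheory intervalIntegral
open Summit.NavierStokesRegularity.NavierStokesRegularity.Theorems.PoloidalWindowDoorLrcModEntireTwistingTHOscUniversalWeightDefs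
open Summit.NavierStokesRegularity.NavierStokesRegularity.Theorems.PoloidalWindowDoorLrcModEntireTwistingTHOscUniversalWeightPieces
open Summit.NavierStokesRegularity.NavierStokesRegularity.Theorems.PoloidalWindowDoorLrcModEntireTwistingTHOscUniversalWeightGlue
open Summit.NavierStokesRegularity.NavierStokesRegularity.Theorems.PoloidalWindowDoorLrcModEntireTwistingTHOscUniversalWeight

variable {A : ℝ}

/-! ### Gaussian decay of the second derivative -/

/-- `u²·e^{−κu²/2} ≤ 2/κ` (from `e^y ≥ 1 + y`). -/
theorem sq_mul_exp_neg_sq_le {κ : ℝ} (hκ : 0 < κ) (u : ℝ) : u ^ 2 * Real.exp (-(κ * u ^ 2 / 2)) ≤ 2 / κ := by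
  have h1 : κ * u ^ 2 / 2 + 1 ≤ Real.exp (κ * u ^ 2 / 2) := Real.add_one_le_exp _
  have hpos : 0 < Real.exp (κ * u ^ 2 / 2) := Real.exp_pos _
  rw [Real.exp_neg, ← div_eq_mul_inv, div_le_div_iff₀ hpos hκ]
  nlinarith [sq_nonneg u]

/-- Decay of the tail curvature: `|w_R″(ξ)| ≤ 4e^{κA²}e^{−(κ/4)ξ²}` for `ξ ≥ A`. -/
theorem abs_wR2_le (hA : 0 < A) {ξ : ℝ} (hξA : A ≤ ξ) :
    |wR2 A ξ| ≤ 4 * Real.exp (kap A * A ^ 2) * Real.exp (-(kap A / 4) * ξ ^ 2) := by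
  have hk := kap_pos hA
  have hk8 := kap_le hA
  have hl := lam_le hA
  have hl0 := lam_nonneg hA
  have hξ0 : 0 ≤ ξ := hA.le.trans hξA
  set u := ξ - A with hu
  have hu0 : 0 ≤ u := by rw [hu]; linarith
  set p := lam A + 2 * kap A * u with hp
  have hw := wR_pos hA ξ
  -- `|wR2| ≤ (p² + 2κ)·wR`
  have habs : |wR2 A ξ| ≤ (p ^ 2 + 2 * kap A) * wR A ξ := by
    unfold wR2
    rw [show ξ - A = u from rfl, abs_mul, abs_of_pos hw]
    refine mul_le_mul_of_nonneg_right ?_ hw.le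
    refine abs_le.2 ⟨?_, ?_⟩ <;> nlinarith [sq_nonneg p]
  -- `wR ≤ e^{−κu²/2}·e^{−κu²/2}`
  have hwle : wR A ξ ≤ Real.exp (-(kap A * u ^ 2 / 2)) * Real.exp (-(kap A * u ^ 2 / 2)) := by
    unfold wR qf
    rw [show ξ - A = u from rfl, ← Real.exp_add]
    have h2 : Real.exp (-(lam A * u + kap A * u ^ 2)) ≤ Real.exp (-(kap A * u ^ 2 / 2) + -(kap A * u ^ 2 / 2)) :=
      Real.exp_le_exp.2 (by nlinarith)
    nlinarith [WA_le_one hA, WA_pos hA, Real.exp_pos (-(lam A * u + kap A * u ^ 2))]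
  -- `(p² + 2κ)e^{−κu²/2} ≤ 2λ² + 2κ + 8κ²·(2/κ) ≤ 3`
  have hfac : (p ^ 2 + 2 * kap A) * Real.exp (-(kap A * u ^ 2 / 2)) ≤ 3 := by
    have h1 := sq_mul_exp_neg_sq_le hk u
    have he1 : Real.exp (-(kap A * u ^ 2 / 2)) ≤ 1 := by rw [Real.exp_le_one_iff]; nlinarith
    have he0 := Real.exp_pos (-(kap A * u ^ 2 / 2))
    have hp2 : p ^ 2 ≤ 2 * lam A ^ 2 + 8 * kap A ^ 2 * u ^ 2 := by rw [hp]; nlinarith [sq_nonneg (lam A - 2 * kap A * u)]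
    have h3 : (p ^ 2 + 2 * kap A) * Real.exp (-(kap A * u ^ 2 / 2)) ≤
        (2 * lam A ^ 2 + 2 * kap A) * Real.exp (-(kap A * u ^ 2 / 2)) + 8 * kap A ^ 2 * (u ^ 2 * Real.exp (-(kap A * u ^ 2 / 2))) := by
      nlinarith
    have h4 : 8 * kap A ^ 2 * (u ^ 2 * Real.exp (-(kap A * u ^ 2 / 2))) ≤ 8 * kap A ^ 2 * (2 / kap A) :=
      mul_le_mul_of_nonneg_left h1 (by positivity)
    have e4 : 8 * kap A ^ 2 * (2 / kap A) = 16 * kap A := by field_simp; ring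
    have h5 : (2 * lam A ^ 2 + 2 * kap A) * Real.exp (-(kap A * u ^ 2 / 2)) ≤ 2 * lam A ^ 2 + 2 * kap A :=
      mul_le_of_le_one_right (by positivity) he1
    nlinarith
  have htail : Real.exp (-(kap A * u ^ 2 / 2)) ≤ Real.exp (kap A * A ^ 2) * Real.exp (-(kap A / 4) * ξ ^ 2) := by
    rw [← Real.exp_add]
    refine Real.exp_le_exp.2 ?_
    have h3 := sq_shift_ge (A := A) ξ
    rw [abs_of_nonneg hξ0, show ξ - A = u from rfl] at h3
    nlinarith
  have he0 := Real.exp_pos (-(kap A * u ^ 2 / 2))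
  have hp0 : 0 ≤ p ^ 2 + 2 * kap A := by positivity
  calc |wR2 A ξ| ≤ (p ^ 2 + 2 * kap A) * wR A ξ := habs
    _ ≤ (p ^ 2 + 2 * kap A) * (Real.exp (-(kap A * u ^ 2 / 2)) * Real.exp (-(kap A * u ^ 2 / 2))) :=
        mul_le_mul_of_nonneg_left hwle hp0
    _ = ((p ^ 2 + 2 * kap A) * Real.exp (-(kap A * u ^ 2 / 2))) * Real.exp (-(kap A * u ^ 2 / 2)) := by ring
    _ ≤ 3 * Real.exp (-(kap A * u ^ 2 / 2)) := mul_le_mul_of_nonneg_right hfac he0.le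
    _ ≤ 3 * (Real.exp (kap A * A ^ 2) * Real.exp (-(kap A / 4) * ξ ^ 2)) := by nlinarith [htail]
    _ ≤ 4 * Real.exp (kap A * A ^ 2) * Real.exp (-(kap A / 4) * ξ ^ 2) := by
        nlinarith [Real.exp_pos (kap A * A ^ 2), Real.exp_pos (-(kap A / 4) * ξ ^ 2)]

/-- Decay of `w″ = g` on `[0,∞)`: `|w″(ξ)| ≤ 4e^{κA²}e^{−(κ/4)ξ²}`. -/
theorem decay_deriv_deriv_of_nonneg (hA : 0 < A) {ξ : ℝ} (hξ : 0 ≤ ξ) :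
    |gf A ξ| ≤ 4 * Real.exp (kap A * A ^ 2) * Real.exp (-(kap A / 4) * ξ ^ 2) := by
  have hk := kap_pos hA
  by_cases h : ξ ≤ A
  · rw [gf_of_mem hξ h]
    have hlow : 1 ≤ Real.exp (kap A * A ^ 2) * Real.exp (-(kap A / 4) * ξ ^ 2) := by
      rw [← Real.exp_add]
      refine Real.one_le_exp ?_
      nlinarith [mul_le_mul h h hξ hA.le]
    -- `|gL| = γ e^{Aξ/2} ≤ γE = 1/16`
    have h1 : |gL A ξ| = gam A * Real.exp (A * ξ / 2) := by
      unfold gL; rw [abs_mul, abs_neg, abs_of_pos (gam_pos (A := A)), abs_of_pos (Real.exp_pos _)]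
    have h2 : gam A * Real.exp (A * ξ / 2) ≤ 1 / 16 := by
      have hmono : Real.exp (A * ξ / 2) ≤ Real.exp (A * A / 2) := Real.exp_le_exp.2 (by nlinarith)
      have hgE := gam_mul_Ec (A := A)
      unfold Ec at hgE
      nlinarith [gam_pos (A := A)]
    rw [h1]
    nlinarith
  · rw [gf_of_ge hA (le_of_not_ge h)]; exact abs_wR2_le hA (le_of_not_ge h)

/-- **`exists_universalWeight` with the decay of `w″` exported** (the extra conjunct consumed by
`…TwistingTHOscAncientLiouville.eq_zero_of_ancient_oscSubsolution_gaussian`): same `γ, κ, C, w` as in `exists_universalWeight`,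
plus `|w″(ξ)| ≤ C·e^{−κξ²}`. -/
theorem exists_universalWeight₂ {A : ℝ} (hA : 0 < A) :
    ∃ γ κ C : ℝ, 0 < γ ∧ 0 < κ ∧ 0 ≤ C ∧ ∃ w : ℝ → ℝ, ContDiff ℝ 2 w ∧ (∀ ξ, w (-ξ) = w ξ) ∧ (∀ ξ, 0 < w ξ) ∧
      (∀ ξ, 0 ≤ ξ → deriv w ξ ≤ 0) ∧
      (∀ ξ s : ℝ, |s| ≤ A → deriv (deriv w) ξ + (1 / 2) * (ξ + s) * deriv w ξ ≤ -γ * w ξ) ∧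
      (∀ ξ, |w ξ| ≤ C * Real.exp (-κ * ξ ^ 2)) ∧ (∀ ξ, |deriv w ξ| ≤ C * Real.exp (-κ * ξ ^ 2)) ∧
      (∀ ξ, |deriv (deriv w) ξ| ≤ C * Real.exp (-κ * ξ ^ 2)) := by
  refine ⟨gam A, kap A / 4, 4 * Real.exp (kap A * A ^ 2), gam_pos, by linarith [kap_pos hA], by positivity,
    wf A, contDiff_two_wf hA, wf_even, ?_, ?_, ?_, ?_, ?_, ?_⟩
  · intro ξ
    rcases le_or_gt 0 ξ with h | h
    · exact wf_pos_of_nonneg hA h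
    · rw [← wf_even ξ]; exact wf_pos_of_nonneg hA (by linarith)
  · intro ξ hξ
    rw [deriv_wf hA]; exact w1_nonpos_of_nonneg hA hξ
  · intro ξ s hs
    rw [deriv_wf hA, deriv_w1 hA]
    rcases le_or_gt 0 ξ with h | h
    · exact ineq_of_nonneg hA h hs
    · have hs' : |(-s)| ≤ A := by rwa [abs_neg]
      have h1 := ineq_of_nonneg hA (show 0 ≤ -ξ by linarith) hs'
      rw [gf_even, w1_odd, wf_even] at h1
      have e : (1 / 2) * (-ξ + -s) * -w1 A ξ = (1 / 2) * (ξ + s) * w1 A ξ := by ring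
      rw [e] at h1
      exact h1
  · intro ξ
    rcases le_or_gt 0 ξ with h | h
    · have h1 := (decay_of_nonneg hA h).1
      simpa [neg_mul] using h1
    · have h1 := (decay_of_nonneg hA (show 0 ≤ -ξ by linarith)).1
      rw [wf_even] at h1
      simpa [neg_mul] using h1
  · intro ξ
    rw [deriv_wf hA]
    rcases le_or_gt 0 ξ with h | h
    · have h1 := (decay_of_nonneg hA h).2
      simpa [neg_mul] using h1
    · have h1 := (decay_of_nonneg hA (show 0 ≤ -ξ by linarith)).2
      rw [w1_odd, abs_neg] at h1
      simpa [neg_mul] using h1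
  · intro ξ
    rw [deriv_wf hA, deriv_w1 hA]
    rcases le_or_gt 0 ξ with h | h
    · have h1 := decay_deriv_deriv_of_nonneg hA h
      simpa [neg_mul] using h1
    · have h1 := decay_deriv_deriv_of_nonneg hA (show 0 ≤ -ξ by linarith)
      rw [gf_even] at h1
      simpa [neg_mul] using h1

end Summit.NavierStokesRegularity.NavierStokesRegularity.Theorems.PoloidalWindowDoorLrcModEntireTwistingTHOscUniversalWeightCurvature
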